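/-
Copyright: the b2b-balaban T⁴-continuum CRUX team, row NE7b OWNER lineage `t4-ne7b-p1` (gen 137). Project licence.
-/
import Summits.QuantumFields.BalabanUV.T4Continuum.Spine.NE7b.SupBlockThirdCumulantForm

/-!
# THE THIRD DERIVATIVE IS ONE TILTED EXPECTATION OF A CENTRED INTEGRAND — the class-closure plan, item (d).  With the notation of (424)
# (`ν = Z⁻¹e^{−U(ω+ψ)}dN(0,M⁻¹)`, `A_v = U′(ω+ψ)[v]`, `B_vw = U″(ω+ψ)[v,w]`, `C = U‴(ω+ψ)[h,k,l]`, `a_v = E_νA_v`), for a `C³` block input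
# with the four block letters:
#   `T(ψ)[h,k,l] = Z⁻¹∫e^{−U(ω+ψ)}·[ C − (A_k−a_k)B_hl − B_hk(A_l−a_l) − (A_h−a_h)B_kl + (A_h−a_h)(A_k−a_k)(A_l−a_l) ] dN(0,M⁻¹)`
# — (424)'s raw scalar form regrouped: the `Z⁻²G·H` and `2Z⁻³G·G·G` terms are exactly the centring constants.  Every scalar integrand is
# integrable (orders `≤ 3` in `‖U′‖`, (423)), so the regrouping is linearity of the integral.  The centred form is the one whose modulus is
# uniform in the background (successor file) (row NE7b, node U5c; (423)∕(424) BY NAME; [folklore])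

Cell `pub-balaban`, sub-cell `t4`, spine estimate NE7b (`T4WeightBudget.RelWeightBound`; the cell's OWN estimate — NOT PRINTED in
[Bałaban 1983–89], NOT PROVED).  Crux-route work under `Spine/NE7b/` by the row OWNER (`t4-ne7b-p1` gen 137, file (425)) under FREEZE
(0)'s crux-prover clause (this gen's class-closure audit, item (d)); NOTHING of Bałaban's is named as a Lean object, valued or asserted; no
`T4Continuum/Support` leaf typed; no `def`, no notation; zero `sorry`.  Imports (BY NAME): the OWNER's (424) `…SupBlockThirdCumulantForm`
(`hessW_deriv_apply`) and through it (423) (`integrable_block_moments`), (399) (`integrable_exp_neg_block`), (313) (`mul_opBound_le_of_le`).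

WHAT IS PROVED ([folklore]):
* §1 `integrable_scalar_pieces` (`e·C`, `e·B_vw`, `e·A_vB_xy`, `e·B_xyA_v`, `e·A_vA_w`, `e·A_hA_kA_l` integrable);
* §2 `integral_phi_split`, `integral_H_split`, `integral_psi_split` (linearity), THE END **`hessW_deriv_apply_centred`** (the display); §3 toy.

HONEST (what this is NOT).  An identity; the uniform bound is the successor's; no contraction ((β4)), no decaying-covariance polymer expansion
((β3′)); scalar skeleton ((A3), NC-NE7b-α UNRULED); nothing of Bałaban's asserted.  BY-NAME EFFECT ON THE WALL: NONE.  NE7b NOT PRINTED ∕ NOT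
PROVED; spine PROVED 0∕9; rung (B)+1 — the programme's measures remain FINITE-torus statements; NOT the mass gap, NOT Clay.  HONEST DEPENDENCY:
continuum YM on T⁴ ⇐ BetaPertH ∧ nine spine estimates (0∕9 proved); BetaPertH ⇐ (D1) ∧ (D4) ∧ CAP+tail; G-an2-4 gates asym, D1 and NE2∕3∕4.
-/

set_option autoImplicit false
set_option maxSynthPendingDepth 3

noncomputable section

namespace Summit.QuantumFields.BalabanUV.T4Continuum.NE7b.SupBlockThirdCentred

open MeasureTheory ProbabilityTheory Finset Real
open scoped BigOperators Matrix
open SupEffectiveActionDerivative (mul_opBound_le_of_le)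
open SupBlockEffectiveActionDerivative (integrable_exp_neg_block)
open SupBlockFourthMoment (integrable_block_moments)
open SupBlockThirdCumulantForm (hessW_deriv_apply)

variable {ι : Type} [Fintype ι] [DecidableEq ι]

section Main

variable {M : Matrix ι ι ℝ} {γop : ℝ} {U : EuclideanSpace ℝ ι → ℝ} {U' : EuclideanSpace ℝ ι → EuclideanSpace ℝ ι →L[ℝ] ℝ}
  {U'' : EuclideanSpace ℝ ι → EuclideanSpace ℝ ι →L[ℝ] EuclideanSpace ℝ ι →L[ℝ] ℝ}
  {U₃ : EuclideanSpace ℝ ι → EuclideanSpace ℝ ι →L[ℝ] EuclideanSpace ℝ ι →L[ℝ] EuclideanSpace ℝ ι →L[ℝ] ℝ} {κ₀ κ₁ κ₂ κ₃ a τ δ θ : ℝ}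

/-! ## §1. The scalar pieces are integrable -/

/-- **The scalar pieces of the third derivative are integrable** against `e^{−U(ω+ψ)}dN(0,M⁻¹)`: `e·C`, `e·B_vw` (bounded factors),
`e·A_vB_xy`, `e·B_xyA_v` (first moment), `e·A_vA_w` (second), `e·A_hA_kA_l` (third, by `|x|³ ≤ x² + x⁴` and (423)). [folklore] -/
theorem integrable_scalar_pieces (hM : M.PosDef) (hΓop : (γop • (1 : Matrix ι ι ℝ) - M⁻¹).PosSemidef) (Y : Finset ι)
    (hUd : ∀ φ : EuclideanSpace ℝ ι, HasFDerivAt U (U' φ) φ) (hU'd : ∀ φ : EuclideanSpace ℝ ι, HasFDerivAt U' (U'' φ) φ)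
    (hU''d : ∀ φ : EuclideanSpace ℝ ι, HasFDerivAt U'' (U₃ φ) φ) (hU₃c : Continuous U₃) (hκ₀ : 0 ≤ κ₀) (hκ₁ : 0 ≤ κ₁) (ha : 0 ≤ a) (hτ : 0 < τ) (hδ : 0 < δ)
    (hθ0 : 0 < θ) (hθ1 : θ < 1) (hκθ : (2 * κ₀ * (1 + τ) + 4 * δ) * γop ≤ θ) (hstab : ∀ φ : EuclideanSpace ℝ ι, -(κ₀ * ∑ x ∈ Y, φ x ^ 2) ≤ U φ)
    (hU'b : ∀ φ : EuclideanSpace ℝ ι, ‖U' φ‖ ≤ κ₁ * (a + ∑ x ∈ Y, φ x ^ 2)) (hU''b : ∀ φ : EuclideanSpace ℝ ι, ‖U'' φ‖ ≤ κ₂)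
    (hU₃b : ∀ φ : EuclideanSpace ℝ ι, ‖U₃ φ‖ ≤ κ₃) (ψ h k l : EuclideanSpace ℝ ι) :
    Integrable (fun ω : EuclideanSpace ℝ ι => exp (-U (ω + ψ)) * U₃ (ω + ψ) h k l) (multivariateGaussian 0 M⁻¹) ∧
      (∀ v w : EuclideanSpace ℝ ι, Integrable (fun ω : EuclideanSpace ℝ ι => exp (-U (ω + ψ)) * U'' (ω + ψ) v w) (multivariateGaussian 0 M⁻¹)) ∧
      (∀ v x y : EuclideanSpace ℝ ι, Integrable (fun ω : EuclideanSpace ℝ ι => exp (-U (ω + ψ)) * (U' (ω + ψ) v * U'' (ω + ψ) x y)) (multivariateGaussian 0 M⁻¹)) ∧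
      (∀ x y v : EuclideanSpace ℝ ι, Integrable (fun ω : EuclideanSpace ℝ ι => exp (-U (ω + ψ)) * (U'' (ω + ψ) x y * U' (ω + ψ) v)) (multivariateGaussian 0 M⁻¹)) ∧
      (∀ v w : EuclideanSpace ℝ ι, Integrable (fun ω : EuclideanSpace ℝ ι => exp (-U (ω + ψ)) * (U' (ω + ψ) v * U' (ω + ψ) w)) (multivariateGaussian 0 M⁻¹)) ∧
      Integrable (fun ω : EuclideanSpace ℝ ι => exp (-U (ω + ψ)) * (U' (ω + ψ) h * U' (ω + ψ) k * U' (ω + ψ) l)) (multivariateGaussian 0 M⁻¹) := by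
  have hΓ : (M⁻¹).PosSemidef := hM.inv.posSemidef
  have hU''c : Continuous U'' := continuous_iff_continuousAt.2 fun φ => (hU''d φ).continuousAt
  have hU'c : Continuous U' := continuous_iff_continuousAt.2 fun φ => (hU'd φ).continuousAt
  have hUc : Continuous U := continuous_iff_continuousAt.2 fun φ => (hUd φ).continuousAt
  have hκθ₀ : 2 * κ₀ * (1 + τ) * γop ≤ θ := mul_opBound_le_of_le (by positivity) (by linarith) hθ0.le hκθ
  have hI := integrable_exp_neg_block hΓ hΓop Y hUc.measurable hκ₀ hτ hθ1 hκθ₀ hstab ψ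
  have hsh : Continuous fun ω : EuclideanSpace ℝ ι => ω + ψ := continuous_id.add continuous_const
  have hEc : Continuous fun ω : EuclideanSpace ℝ ι => exp (-U (ω + ψ)) := continuous_exp.comp ((hUc.comp hsh).neg)
  have hAc : ∀ v : EuclideanSpace ℝ ι, Continuous fun ω : EuclideanSpace ℝ ι => U' (ω + ψ) v := fun v => (hU'c.comp hsh).clm_apply continuous_const
  have hBc : ∀ v w : EuclideanSpace ℝ ι, Continuous fun ω : EuclideanSpace ℝ ι => U'' (ω + ψ) v w := fun v w =>
    ((hU''c.comp hsh).clm_apply continuous_const).clm_apply continuous_const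
  have hCc : Continuous fun ω : EuclideanSpace ℝ ι => U₃ (ω + ψ) h k l :=
    (((hU₃c.comp hsh).clm_apply continuous_const).clm_apply continuous_const).clm_apply continuous_const
  obtain ⟨i1, i2, i4⟩ := integrable_block_moments hΓ hΓop Y hUd hU'c hκ₀ hκ₁ ha hτ hδ hθ1 hκθ hstab hU'b ψ
  have hAb : ∀ (v : EuclideanSpace ℝ ι) (ω : EuclideanSpace ℝ ι), |U' (ω + ψ) v| ≤ ‖U' (ω + ψ)‖ * ‖v‖ := fun v ω => by
    rw [← Real.norm_eq_abs]; exact ContinuousLinearMap.le_opNorm _ _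
  have hBb : ∀ (v w : EuclideanSpace ℝ ι) (ω : EuclideanSpace ℝ ι), |U'' (ω + ψ) v w| ≤ κ₂ * ‖v‖ * ‖w‖ := fun v w ω => by
    rw [← Real.norm_eq_abs]
    calc ‖U'' (ω + ψ) v w‖ ≤ ‖U'' (ω + ψ)‖ * ‖v‖ * ‖w‖ := ContinuousLinearMap.le_opNorm₂ _ _ _
      _ ≤ κ₂ * ‖v‖ * ‖w‖ := by gcongr; exact hU''b _
  have iC : Integrable (fun ω : EuclideanSpace ℝ ι => exp (-U (ω + ψ)) * U₃ (ω + ψ) h k l) (multivariateGaussian 0 M⁻¹) := by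
    refine (hI.mul_const (κ₃ * ‖h‖ * ‖k‖ * ‖l‖)).mono' ((hEc.mul hCc).aestronglyMeasurable) (ae_of_all _ fun ω => ?_)
    rw [Real.norm_eq_abs, abs_mul, abs_of_pos (exp_pos _)]
    refine mul_le_mul_of_nonneg_left ?_ (exp_pos _).le
    rw [← Real.norm_eq_abs]
    calc ‖U₃ (ω + ψ) h k l‖ ≤ ‖U₃ (ω + ψ) h k‖ * ‖l‖ := ContinuousLinearMap.le_opNorm _ _
      _ ≤ ‖U₃ (ω + ψ) h‖ * ‖k‖ * ‖l‖ := by gcongr; exact ContinuousLinearMap.le_opNorm _ _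
      _ ≤ ‖U₃ (ω + ψ)‖ * ‖h‖ * ‖k‖ * ‖l‖ := by gcongr; exact ContinuousLinearMap.le_opNorm _ _
      _ ≤ κ₃ * ‖h‖ * ‖k‖ * ‖l‖ := by gcongr; exact hU₃b _
  have iB : ∀ v w : EuclideanSpace ℝ ι, Integrable (fun ω : EuclideanSpace ℝ ι => exp (-U (ω + ψ)) * U'' (ω + ψ) v w) (multivariateGaussian 0 M⁻¹) := fun v w =>
    (hI.mul_const (κ₂ * ‖v‖ * ‖w‖)).mono' ((hEc.mul (hBc v w)).aestronglyMeasurable) (ae_of_all _ fun ω => by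
      rw [Real.norm_eq_abs, abs_mul, abs_of_pos (exp_pos _)]
      exact mul_le_mul_of_nonneg_left (hBb v w ω) (exp_pos _).le)
  have iAB : ∀ v x y : EuclideanSpace ℝ ι, Integrable (fun ω : EuclideanSpace ℝ ι => exp (-U (ω + ψ)) * (U' (ω + ψ) v * U'' (ω + ψ) x y)) (multivariateGaussian 0 M⁻¹) :=
      fun v x y =>
    (i1.mul_const (‖v‖ * (κ₂ * ‖x‖ * ‖y‖))).mono' ((hEc.mul ((hAc v).mul (hBc x y))).aestronglyMeasurable) (ae_of_all _ fun ω => by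
      rw [Real.norm_eq_abs, abs_mul, abs_of_pos (exp_pos _), abs_mul]
      have h1 := hAb v ω; have h2 := hBb x y ω
      have h3 : |U' (ω + ψ) v| * |U'' (ω + ψ) x y| ≤ (‖U' (ω + ψ)‖ * ‖v‖) * (κ₂ * ‖x‖ * ‖y‖) := mul_le_mul h1 h2 (abs_nonneg _) (by positivity)
      nlinarith [exp_pos (-U (ω + ψ))])
  have iBA : ∀ x y v : EuclideanSpace ℝ ι, Integrable (fun ω : EuclideanSpace ℝ ι => exp (-U (ω + ψ)) * (U'' (ω + ψ) x y * U' (ω + ψ) v)) (multivariateGaussian 0 M⁻¹) :=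
      fun x y v =>
    (iAB v x y).congr (ae_of_all _ fun ω => by ring)
  have iAA : ∀ v w : EuclideanSpace ℝ ι, Integrable (fun ω : EuclideanSpace ℝ ι => exp (-U (ω + ψ)) * (U' (ω + ψ) v * U' (ω + ψ) w)) (multivariateGaussian 0 M⁻¹) := fun v w
      =>
    (i2.mul_const (‖v‖ * ‖w‖)).mono' ((hEc.mul ((hAc v).mul (hAc w))).aestronglyMeasurable) (ae_of_all _ fun ω => by
      rw [Real.norm_eq_abs, abs_mul, abs_of_pos (exp_pos _), abs_mul]
      have h3 : |U' (ω + ψ) v| * |U' (ω + ψ) w| ≤ (‖U' (ω + ψ)‖ * ‖v‖) * (‖U' (ω + ψ)‖ * ‖w‖) :=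
        mul_le_mul (hAb v ω) (hAb w ω) (abs_nonneg _) (by positivity)
      nlinarith [exp_pos (-U (ω + ψ))])
  have iAAA : Integrable (fun ω : EuclideanSpace ℝ ι => exp (-U (ω + ψ)) * (U' (ω + ψ) h * U' (ω + ψ) k * U' (ω + ψ) l)) (multivariateGaussian 0 M⁻¹) := by
    refine ((i2.add i4).mul_const (‖h‖ * ‖k‖ * ‖l‖)).mono' ((hEc.mul (((hAc h).mul (hAc k)).mul (hAc l))).aestronglyMeasurable)
      (ae_of_all _ fun ω => ?_)
    rw [Real.norm_eq_abs, abs_mul, abs_of_pos (exp_pos _), abs_mul, abs_mul, Pi.add_apply]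
    set n : ℝ := ‖U' (ω + ψ)‖ with hn
    have hn0 : 0 ≤ n := norm_nonneg _
    have h3 : |U' (ω + ψ) h| * |U' (ω + ψ) k| * |U' (ω + ψ) l| ≤ (n * ‖h‖) * (n * ‖k‖) * (n * ‖l‖) :=
      mul_le_mul (mul_le_mul (hAb h ω) (hAb k ω) (abs_nonneg _) (by positivity)) (hAb l ω) (abs_nonneg _) (by positivity)
    have hcube : n ^ 3 ≤ n ^ 2 + n ^ 4 := by nlinarith [sq_nonneg (n - 1), sq_nonneg n, hn0]
    have e0 := exp_pos (-U (ω + ψ))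
    have hP0 : 0 ≤ ‖h‖ * ‖k‖ * ‖l‖ := by positivity
    have h4 : |U' (ω + ψ) h| * |U' (ω + ψ) k| * |U' (ω + ψ) l| ≤ n ^ 3 * (‖h‖ * ‖k‖ * ‖l‖) := h3.trans (le_of_eq (by ring))
    have h5 : n ^ 3 * (‖h‖ * ‖k‖ * ‖l‖) ≤ (n ^ 2 + n ^ 4) * (‖h‖ * ‖k‖ * ‖l‖) := mul_le_mul_of_nonneg_right hcube hP0
    calc exp (-U (ω + ψ)) * (|U' (ω + ψ) h| * |U' (ω + ψ) k| * |U' (ω + ψ) l|)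
        ≤ exp (-U (ω + ψ)) * ((n ^ 2 + n ^ 4) * (‖h‖ * ‖k‖ * ‖l‖)) := mul_le_mul_of_nonneg_left (h4.trans h5) e0.le
      _ = (exp (-U (ω + ψ)) * n ^ 2 + exp (-U (ω + ψ)) * n ^ 4) * (‖h‖ * ‖k‖ * ‖l‖) := by ring
  exact ⟨iC, iB, iAB, iBA, iAA, iAAA⟩

/-! ## §2. Linearity: the raw form equals the centred form -/

/-- `∫Φ[h,k,l]` split into its five scalar integrals. [folklore] -/
theorem integral_phi_split (hM : M.PosDef) (hΓop : (γop • (1 : Matrix ι ι ℝ) - M⁻¹).PosSemidef) (Y : Finset ι)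
    (hUd : ∀ φ : EuclideanSpace ℝ ι, HasFDerivAt U (U' φ) φ) (hU'd : ∀ φ : EuclideanSpace ℝ ι, HasFDerivAt U' (U'' φ) φ)
    (hU''d : ∀ φ : EuclideanSpace ℝ ι, HasFDerivAt U'' (U₃ φ) φ) (hU₃c : Continuous U₃) (hκ₀ : 0 ≤ κ₀) (hκ₁ : 0 ≤ κ₁) (ha : 0 ≤ a) (hτ : 0 < τ) (hδ : 0 < δ)
    (hθ0 : 0 < θ) (hθ1 : θ < 1) (hκθ : (2 * κ₀ * (1 + τ) + 4 * δ) * γop ≤ θ) (hstab : ∀ φ : EuclideanSpace ℝ ι, -(κ₀ * ∑ x ∈ Y, φ x ^ 2) ≤ U φ)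
    (hU'b : ∀ φ : EuclideanSpace ℝ ι, ‖U' φ‖ ≤ κ₁ * (a + ∑ x ∈ Y, φ x ^ 2)) (hU''b : ∀ φ : EuclideanSpace ℝ ι, ‖U'' φ‖ ≤ κ₂)
    (hU₃b : ∀ φ : EuclideanSpace ℝ ι, ‖U₃ φ‖ ≤ κ₃) (ψ h k l : EuclideanSpace ℝ ι) :
    (∫ ω : EuclideanSpace ℝ ι, (exp (-U (ω + ψ)) * (U₃ (ω + ψ) h k l - U' (ω + ψ) k * U'' (ω + ψ) h l - U'' (ω + ψ) h k * U' (ω + ψ) l - U' (ω + ψ) h * U'' (ω + ψ) k l + U'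
        (ω + ψ) h * U' (ω + ψ) k * U' (ω + ψ) l)) ∂(multivariateGaussian 0 M⁻¹)) = (∫ ω : EuclideanSpace ℝ ι, exp (-U (ω + ψ)) * U₃ (ω + ψ) h k l ∂(multivariateGaussian 0
        M⁻¹)) - (∫ ω : EuclideanSpace ℝ ι, exp (-U (ω + ψ)) * (U' (ω + ψ) k * U'' (ω + ψ) h l) ∂(multivariateGaussian 0 M⁻¹)) - (∫ ω : EuclideanSpace ℝ ι, exp (-U (ω + ψ))
        * (U'' (ω + ψ) h k * U' (ω + ψ) l) ∂(multivariateGaussian 0 M⁻¹)) - (∫ ω : EuclideanSpace ℝ ι, exp (-U (ω + ψ)) * (U' (ω + ψ) h * U'' (ω + ψ) k l)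
        ∂(multivariateGaussian 0 M⁻¹)) + (∫ ω : EuclideanSpace ℝ ι, exp (-U (ω + ψ)) * (U' (ω + ψ) h * U' (ω + ψ) k * U' (ω + ψ) l) ∂(multivariateGaussian 0 M⁻¹)) := by
  obtain ⟨iC, iB, iAB, iBA, iAA, iAAA⟩ := integrable_scalar_pieces hM hΓop Y hUd hU'd hU''d hU₃c hκ₀ hκ₁ ha hτ hδ hθ0 hθ1 hκθ hstab hU'b hU''b hU₃b ψ h k l
  have e1 : ∀ ω : EuclideanSpace ℝ ι, (exp (-U (ω + ψ)) * (U₃ (ω + ψ) h k l - U' (ω + ψ) k * U'' (ω + ψ) h l - U'' (ω + ψ) h k * U' (ω + ψ) l - U' (ω + ψ) h * U'' (ω + ψ) k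
      l + U' (ω + ψ) h * U' (ω + ψ) k * U' (ω + ψ) l)) = exp (-U (ω + ψ)) * U₃ (ω + ψ) h k l - exp (-U (ω + ψ)) * (U' (ω + ψ) k * U'' (ω + ψ) h l) - exp (-U (ω + ψ)) * (U''
      (ω + ψ) h k * U' (ω + ψ) l) -
      exp (-U (ω + ψ)) * (U' (ω + ψ) h * U'' (ω + ψ) k l) + exp (-U (ω + ψ)) * (U' (ω + ψ) h * U' (ω + ψ) k * U' (ω + ψ) l) := fun ω => by ring
  simp_rw [e1]
  have s1 : Integrable (fun ω : EuclideanSpace ℝ ι => exp (-U (ω + ψ)) * U₃ (ω + ψ) h k l - exp (-U (ω + ψ)) * (U' (ω + ψ) k * U'' (ω + ψ) h l)) (multivariateGaussian 0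
      M⁻¹) := iC.sub (iAB k h l)
  have s2 : Integrable (fun ω : EuclideanSpace ℝ ι => exp (-U (ω + ψ)) * U₃ (ω + ψ) h k l - exp (-U (ω + ψ)) * (U' (ω + ψ) k * U'' (ω + ψ) h l) - exp (-U (ω + ψ)) * (U'' (ω
      + ψ) h k * U' (ω + ψ) l)) (multivariateGaussian 0 M⁻¹) := s1.sub (iBA h k l)
  have s3 : Integrable (fun ω : EuclideanSpace ℝ ι => exp (-U (ω + ψ)) * U₃ (ω + ψ) h k l - exp (-U (ω + ψ)) * (U' (ω + ψ) k * U'' (ω + ψ) h l) - exp (-U (ω + ψ)) * (U'' (ω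
      + ψ) h k * U' (ω + ψ) l) - exp (-U (ω + ψ)) * (U' (ω + ψ) h * U'' (ω + ψ) k l)) (multivariateGaussian 0 M⁻¹) := s2.sub (iAB h k l)
  rw [integral_add s3 iAAA, integral_sub s2 (iAB h k l), integral_sub s1 (iBA h k l), integral_sub iC (iAB k h l)]

/-- `∫e(B_vw − A_vA_w) = ∫eB_vw − ∫eA_vA_w`. [folklore] -/
theorem integral_H_split (hM : M.PosDef) (hΓop : (γop • (1 : Matrix ι ι ℝ) - M⁻¹).PosSemidef) (Y : Finset ι)
    (hUd : ∀ φ : EuclideanSpace ℝ ι, HasFDerivAt U (U' φ) φ) (hU'd : ∀ φ : EuclideanSpace ℝ ι, HasFDerivAt U' (U'' φ) φ)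
    (hU''d : ∀ φ : EuclideanSpace ℝ ι, HasFDerivAt U'' (U₃ φ) φ) (hU₃c : Continuous U₃) (hκ₀ : 0 ≤ κ₀) (hκ₁ : 0 ≤ κ₁) (ha : 0 ≤ a) (hτ : 0 < τ) (hδ : 0 < δ)
    (hθ0 : 0 < θ) (hθ1 : θ < 1) (hκθ : (2 * κ₀ * (1 + τ) + 4 * δ) * γop ≤ θ) (hstab : ∀ φ : EuclideanSpace ℝ ι, -(κ₀ * ∑ x ∈ Y, φ x ^ 2) ≤ U φ)
    (hU'b : ∀ φ : EuclideanSpace ℝ ι, ‖U' φ‖ ≤ κ₁ * (a + ∑ x ∈ Y, φ x ^ 2)) (hU''b : ∀ φ : EuclideanSpace ℝ ι, ‖U'' φ‖ ≤ κ₂)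
    (hU₃b : ∀ φ : EuclideanSpace ℝ ι, ‖U₃ φ‖ ≤ κ₃) (ψ v w : EuclideanSpace ℝ ι) :
    (∫ ω : EuclideanSpace ℝ ι, exp (-U (ω + ψ)) * (U'' (ω + ψ) v w - U' (ω + ψ) v * U' (ω + ψ) w) ∂(multivariateGaussian 0 M⁻¹)) = (∫ ω : EuclideanSpace ℝ ι, exp (-U (ω +
        ψ)) * U'' (ω + ψ) v w ∂(multivariateGaussian 0 M⁻¹)) - (∫ ω : EuclideanSpace ℝ ι, exp (-U (ω + ψ)) * (U' (ω + ψ) v * U' (ω + ψ) w) ∂(multivariateGaussian 0 M⁻¹)) :=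
        by
  obtain ⟨-, iB, -, -, iAA, -⟩ := integrable_scalar_pieces hM hΓop Y hUd hU'd hU''d hU₃c hκ₀ hκ₁ ha hτ hδ hθ0 hθ1 hκθ hstab hU'b hU''b hU₃b ψ v v v
  have e1 : ∀ ω : EuclideanSpace ℝ ι, exp (-U (ω + ψ)) * (U'' (ω + ψ) v w - U' (ω + ψ) v * U' (ω + ψ) w) = exp (-U (ω + ψ)) * U'' (ω + ψ) v w - exp (-U (ω + ψ)) * (U' (ω +
      ψ) v * U' (ω + ψ) w) := fun ω => by ring
  simp_rw [e1]
  exact integral_sub (iB v w) (iAA v w)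

/-- `∫e·Ψ` split into the scalar integrals (`Ψ` the centred integrand; fifteen terms). [folklore] -/
theorem integral_psi_split (hM : M.PosDef) (hΓop : (γop • (1 : Matrix ι ι ℝ) - M⁻¹).PosSemidef) (Y : Finset ι)
    (hUd : ∀ φ : EuclideanSpace ℝ ι, HasFDerivAt U (U' φ) φ) (hU'd : ∀ φ : EuclideanSpace ℝ ι, HasFDerivAt U' (U'' φ) φ)
    (hU''d : ∀ φ : EuclideanSpace ℝ ι, HasFDerivAt U'' (U₃ φ) φ) (hU₃c : Continuous U₃) (hκ₀ : 0 ≤ κ₀) (hκ₁ : 0 ≤ κ₁) (ha : 0 ≤ a) (hτ : 0 < τ) (hδ : 0 < δ)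
    (hθ0 : 0 < θ) (hθ1 : θ < 1) (hκθ : (2 * κ₀ * (1 + τ) + 4 * δ) * γop ≤ θ) (hstab : ∀ φ : EuclideanSpace ℝ ι, -(κ₀ * ∑ x ∈ Y, φ x ^ 2) ≤ U φ)
    (hU'b : ∀ φ : EuclideanSpace ℝ ι, ‖U' φ‖ ≤ κ₁ * (a + ∑ x ∈ Y, φ x ^ 2)) (hU''b : ∀ φ : EuclideanSpace ℝ ι, ‖U'' φ‖ ≤ κ₂)
    (hU₃b : ∀ φ : EuclideanSpace ℝ ι, ‖U₃ φ‖ ≤ κ₃) (ψ h k l : EuclideanSpace ℝ ι) :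
    (∫ ω : EuclideanSpace ℝ ι, exp (-U (ω + ψ)) * (U₃ (ω + ψ) h k l - (U' (ω + ψ) k - ((∫ ω : EuclideanSpace ℝ ι, exp (-U (ω + ψ)) ∂(multivariateGaussian 0 M⁻¹))⁻¹ * (∫ ω :
        EuclideanSpace ℝ ι, exp (-U (ω + ψ)) * U' (ω + ψ) k ∂(multivariateGaussian 0 M⁻¹)))) * U'' (ω + ψ) h l - U'' (ω + ψ) h k * (U' (ω + ψ) l - ((∫ ω : EuclideanSpace ℝ
        ι, exp (-U (ω + ψ)) ∂(multivariateGaussian 0 M⁻¹))⁻¹ * (∫ ω : EuclideanSpace ℝ ι, exp (-U (ω + ψ)) * U' (ω + ψ) l ∂(multivariateGaussian 0 M⁻¹)))) - (U' (ω + ψ) h -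
        ((∫ ω : EuclideanSpace ℝ ι, exp (-U (ω + ψ)) ∂(multivariateGaussian 0 M⁻¹))⁻¹ * (∫ ω : EuclideanSpace ℝ ι, exp (-U (ω + ψ)) * U' (ω + ψ) h ∂(multivariateGaussian 0
        M⁻¹)))) * U'' (ω + ψ) k l + (U' (ω + ψ) h - ((∫ ω : EuclideanSpace ℝ ι, exp (-U (ω + ψ)) ∂(multivariateGaussian 0 M⁻¹))⁻¹ * (∫ ω : EuclideanSpace ℝ ι, exp (-U (ω +
        ψ)) * U' (ω + ψ) h ∂(multivariateGaussian 0 M⁻¹)))) * (U' (ω + ψ) k - ((∫ ω : EuclideanSpace ℝ ι, exp (-U (ω + ψ)) ∂(multivariateGaussian 0 M⁻¹))⁻¹ * (∫ ω :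
        EuclideanSpace ℝ ι, exp (-U (ω + ψ)) * U' (ω + ψ) k ∂(multivariateGaussian 0 M⁻¹)))) * (U' (ω + ψ) l - ((∫ ω : EuclideanSpace ℝ ι, exp (-U (ω + ψ))
        ∂(multivariateGaussian 0 M⁻¹))⁻¹ * (∫ ω : EuclideanSpace ℝ ι, exp (-U (ω + ψ)) * U' (ω + ψ) l ∂(multivariateGaussian 0 M⁻¹))))) ∂(multivariateGaussian 0 M⁻¹)) =
      (∫ ω : EuclideanSpace ℝ ι, exp (-U (ω + ψ)) * U₃ (ω + ψ) h k l ∂(multivariateGaussian 0 M⁻¹)) - ((∫ ω : EuclideanSpace ℝ ι, exp (-U (ω + ψ)) * (U' (ω + ψ) k * U'' (ω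
          + ψ) h l) ∂(multivariateGaussian 0 M⁻¹)) - ((∫ ω : EuclideanSpace ℝ ι, exp (-U (ω + ψ)) ∂(multivariateGaussian 0 M⁻¹))⁻¹ * (∫ ω : EuclideanSpace ℝ ι, exp (-U (ω +
          ψ)) * U' (ω + ψ) k ∂(multivariateGaussian 0 M⁻¹))) * (∫ ω : EuclideanSpace ℝ ι, exp (-U (ω + ψ)) * U'' (ω + ψ) h l ∂(multivariateGaussian 0 M⁻¹))) - ((∫ ω :
          EuclideanSpace ℝ ι, exp (-U (ω + ψ)) * (U'' (ω + ψ) h k * U' (ω + ψ) l) ∂(multivariateGaussian 0 M⁻¹)) - ((∫ ω : EuclideanSpace ℝ ι, exp (-U (ω + ψ))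
          ∂(multivariateGaussian 0 M⁻¹))⁻¹ * (∫ ω : EuclideanSpace ℝ ι, exp (-U (ω + ψ)) * U' (ω + ψ) l ∂(multivariateGaussian 0 M⁻¹))) * (∫ ω : EuclideanSpace ℝ ι, exp (-U
          (ω + ψ)) * U'' (ω + ψ) h k ∂(multivariateGaussian 0 M⁻¹))) -
        ((∫ ω : EuclideanSpace ℝ ι, exp (-U (ω + ψ)) * (U' (ω + ψ) h * U'' (ω + ψ) k l) ∂(multivariateGaussian 0 M⁻¹)) - ((∫ ω : EuclideanSpace ℝ ι, exp (-U (ω + ψ))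
            ∂(multivariateGaussian 0 M⁻¹))⁻¹ * (∫ ω : EuclideanSpace ℝ ι, exp (-U (ω + ψ)) * U' (ω + ψ) h ∂(multivariateGaussian 0 M⁻¹))) * (∫ ω : EuclideanSpace ℝ ι, exp
            (-U (ω + ψ)) * U'' (ω + ψ) k l ∂(multivariateGaussian 0 M⁻¹))) +
        ((∫ ω : EuclideanSpace ℝ ι, exp (-U (ω + ψ)) * (U' (ω + ψ) h * U' (ω + ψ) k * U' (ω + ψ) l) ∂(multivariateGaussian 0 M⁻¹)) - ((∫ ω : EuclideanSpace ℝ ι, exp (-U (ω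
            + ψ)) ∂(multivariateGaussian 0 M⁻¹))⁻¹ * (∫ ω : EuclideanSpace ℝ ι, exp (-U (ω + ψ)) * U' (ω + ψ) h ∂(multivariateGaussian 0 M⁻¹))) * (∫ ω : EuclideanSpace ℝ ι,
            exp (-U (ω + ψ)) * (U' (ω + ψ) k * U' (ω + ψ) l) ∂(multivariateGaussian 0 M⁻¹)) - ((∫ ω : EuclideanSpace ℝ ι, exp (-U (ω + ψ)) ∂(multivariateGaussian 0 M⁻¹))⁻¹
            * (∫ ω : EuclideanSpace ℝ ι, exp (-U (ω + ψ)) * U' (ω + ψ) k ∂(multivariateGaussian 0 M⁻¹))) * (∫ ω : EuclideanSpace ℝ ι, exp (-U (ω + ψ)) * (U' (ω + ψ) h * U'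
            (ω + ψ) l) ∂(multivariateGaussian 0 M⁻¹)) - ((∫ ω : EuclideanSpace ℝ ι, exp (-U (ω + ψ)) ∂(multivariateGaussian 0 M⁻¹))⁻¹ * (∫ ω : EuclideanSpace ℝ ι, exp (-U
            (ω + ψ)) * U' (ω + ψ) l ∂(multivariateGaussian 0 M⁻¹))) * (∫ ω : EuclideanSpace ℝ ι, exp (-U (ω + ψ)) * (U' (ω + ψ) h * U' (ω + ψ) k) ∂(multivariateGaussian 0
            M⁻¹)) + ((∫ ω : EuclideanSpace ℝ ι, exp (-U (ω + ψ)) ∂(multivariateGaussian 0 M⁻¹))⁻¹ * (∫ ω : EuclideanSpace ℝ ι, exp (-U (ω + ψ)) * U' (ω + ψ) h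
            ∂(multivariateGaussian 0 M⁻¹))) * ((∫ ω : EuclideanSpace ℝ ι, exp (-U (ω + ψ)) ∂(multivariateGaussian 0 M⁻¹))⁻¹ * (∫ ω : EuclideanSpace ℝ ι, exp (-U (ω + ψ)) *
            U' (ω + ψ) k ∂(multivariateGaussian 0 M⁻¹))) * (∫ ω : EuclideanSpace ℝ ι, exp (-U (ω + ψ)) * U' (ω + ψ) l ∂(multivariateGaussian 0 M⁻¹)) +
          ((∫ ω : EuclideanSpace ℝ ι, exp (-U (ω + ψ)) ∂(multivariateGaussian 0 M⁻¹))⁻¹ * (∫ ω : EuclideanSpace ℝ ι, exp (-U (ω + ψ)) * U' (ω + ψ) h ∂(multivariateGaussian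
              0 M⁻¹))) * ((∫ ω : EuclideanSpace ℝ ι, exp (-U (ω + ψ)) ∂(multivariateGaussian 0 M⁻¹))⁻¹ * (∫ ω : EuclideanSpace ℝ ι, exp (-U (ω + ψ)) * U' (ω + ψ) l
              ∂(multivariateGaussian 0 M⁻¹))) * (∫ ω : EuclideanSpace ℝ ι, exp (-U (ω + ψ)) * U' (ω + ψ) k ∂(multivariateGaussian 0 M⁻¹)) + ((∫ ω : EuclideanSpace ℝ ι, exp
              (-U (ω + ψ)) ∂(multivariateGaussian 0 M⁻¹))⁻¹ * (∫ ω : EuclideanSpace ℝ ι, exp (-U (ω + ψ)) * U' (ω + ψ) k ∂(multivariateGaussian 0 M⁻¹))) * ((∫ ω :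
              EuclideanSpace ℝ ι, exp (-U (ω + ψ)) ∂(multivariateGaussian 0 M⁻¹))⁻¹ * (∫ ω : EuclideanSpace ℝ ι, exp (-U (ω + ψ)) * U' (ω + ψ) l ∂(multivariateGaussian 0
              M⁻¹))) * (∫ ω : EuclideanSpace ℝ ι, exp (-U (ω + ψ)) * U' (ω + ψ) h ∂(multivariateGaussian 0 M⁻¹)) - ((∫ ω : EuclideanSpace ℝ ι, exp (-U (ω + ψ))
              ∂(multivariateGaussian 0 M⁻¹))⁻¹ * (∫ ω : EuclideanSpace ℝ ι, exp (-U (ω + ψ)) * U' (ω + ψ) h ∂(multivariateGaussian 0 M⁻¹))) * ((∫ ω : EuclideanSpace ℝ ι,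
              exp (-U (ω + ψ)) ∂(multivariateGaussian 0 M⁻¹))⁻¹ * (∫ ω : EuclideanSpace ℝ ι, exp (-U (ω + ψ)) * U' (ω + ψ) k ∂(multivariateGaussian 0 M⁻¹))) * ((∫ ω :
              EuclideanSpace ℝ ι, exp (-U (ω + ψ)) ∂(multivariateGaussian 0 M⁻¹))⁻¹ * (∫ ω : EuclideanSpace ℝ ι, exp (-U (ω + ψ)) * U' (ω + ψ) l ∂(multivariateGaussian 0
              M⁻¹))) * (∫ ω : EuclideanSpace ℝ ι, exp (-U (ω + ψ)) ∂(multivariateGaussian 0 M⁻¹))) := by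
  obtain ⟨iC, iB, iAB, iBA, iAA, iAAA⟩ := integrable_scalar_pieces hM hΓop Y hUd hU'd hU''d hU₃c hκ₀ hκ₁ ha hτ hδ hθ0 hθ1 hκθ hstab hU'b hU''b hU₃b ψ h k l
  have hΓ : (M⁻¹).PosSemidef := hM.inv.posSemidef
  have hU'c : Continuous U' := continuous_iff_continuousAt.2 fun φ => (hU'd φ).continuousAt
  have hUc : Continuous U := continuous_iff_continuousAt.2 fun φ => (hUd φ).continuousAt
  have hκθ₀ : 2 * κ₀ * (1 + τ) * γop ≤ θ := mul_opBound_le_of_le (by positivity) (by linarith) hθ0.le hκθ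
  have hI := integrable_exp_neg_block hΓ hΓop Y hUc.measurable hκ₀ hτ hθ1 hκθ₀ hstab ψ
  have iA : ∀ v : EuclideanSpace ℝ ι, Integrable (fun ω : EuclideanSpace ℝ ι => exp (-U (ω + ψ)) * U' (ω + ψ) v) (multivariateGaussian 0 M⁻¹) := fun v =>
    SupBlockUpperLetter.integrable_weighted_blockDeriv_apply hΓ hΓop Y hUd hU'c hκ₀ hκ₁ ha hτ hδ hθ1 hκθ hstab hU'b ψ v
  set ah : ℝ := ((∫ ω : EuclideanSpace ℝ ι, exp (-U (ω + ψ)) ∂(multivariateGaussian 0 M⁻¹))⁻¹ * (∫ ω : EuclideanSpace ℝ ι, exp (-U (ω + ψ)) * U' (ω + ψ) h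
      ∂(multivariateGaussian 0 M⁻¹))) with hah
  set ak : ℝ := ((∫ ω : EuclideanSpace ℝ ι, exp (-U (ω + ψ)) ∂(multivariateGaussian 0 M⁻¹))⁻¹ * (∫ ω : EuclideanSpace ℝ ι, exp (-U (ω + ψ)) * U' (ω + ψ) k
      ∂(multivariateGaussian 0 M⁻¹))) with hak
  set al : ℝ := ((∫ ω : EuclideanSpace ℝ ι, exp (-U (ω + ψ)) ∂(multivariateGaussian 0 M⁻¹))⁻¹ * (∫ ω : EuclideanSpace ℝ ι, exp (-U (ω + ψ)) * U' (ω + ψ) l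
      ∂(multivariateGaussian 0 M⁻¹))) with hal
  -- pointwise: `e·Ψ` as a combination of the scalar integrands
  have e1 : ∀ ω : EuclideanSpace ℝ ι, exp (-U (ω + ψ)) * (U₃ (ω + ψ) h k l - (U' (ω + ψ) k - ak) * U'' (ω + ψ) h l - U'' (ω + ψ) h k * (U' (ω + ψ) l - al) - (U' (ω + ψ) h -
      ah) * U'' (ω + ψ) k l +
      (U' (ω + ψ) h - ah) * (U' (ω + ψ) k - ak) * (U' (ω + ψ) l - al)) =
      exp (-U (ω + ψ)) * U₃ (ω + ψ) h k l - (exp (-U (ω + ψ)) * (U' (ω + ψ) k * U'' (ω + ψ) h l) - ak * (exp (-U (ω + ψ)) * U'' (ω + ψ) h l)) - (exp (-U (ω + ψ)) * (U'' (ω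
          + ψ) h k * U' (ω + ψ) l) - al * (exp (-U (ω + ψ)) * U'' (ω + ψ) h k)) -
        (exp (-U (ω + ψ)) * (U' (ω + ψ) h * U'' (ω + ψ) k l) - ah * (exp (-U (ω + ψ)) * U'' (ω + ψ) k l)) +
        (exp (-U (ω + ψ)) * (U' (ω + ψ) h * U' (ω + ψ) k * U' (ω + ψ) l) - ah * (exp (-U (ω + ψ)) * (U' (ω + ψ) k * U' (ω + ψ) l)) - ak * (exp (-U (ω + ψ)) * (U' (ω + ψ) h
            * U' (ω + ψ) l)) - al * (exp (-U (ω + ψ)) * (U' (ω + ψ) h * U' (ω + ψ) k)) +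
          ah * ak * (exp (-U (ω + ψ)) * U' (ω + ψ) l) + ah * al * (exp (-U (ω + ψ)) * U' (ω + ψ) k) + ak * al * (exp (-U (ω + ψ)) * U' (ω + ψ) h) - ah * ak * al * exp (-U
              (ω + ψ))) := fun ω => by ring
  simp_rw [e1]
  -- the four groups
  have g2 : Integrable (fun ω : EuclideanSpace ℝ ι => exp (-U (ω + ψ)) * (U' (ω + ψ) k * U'' (ω + ψ) h l) - ak * (exp (-U (ω + ψ)) * U'' (ω + ψ) h l)) (multivariateGaussian
      0 M⁻¹) := (iAB k h l).sub ((iB h l).const_mul ak)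
  have g3 : Integrable (fun ω : EuclideanSpace ℝ ι => exp (-U (ω + ψ)) * (U'' (ω + ψ) h k * U' (ω + ψ) l) - al * (exp (-U (ω + ψ)) * U'' (ω + ψ) h k)) (multivariateGaussian
      0 M⁻¹) := (iBA h k l).sub ((iB h k).const_mul al)
  have g4 : Integrable (fun ω : EuclideanSpace ℝ ι => exp (-U (ω + ψ)) * (U' (ω + ψ) h * U'' (ω + ψ) k l) - ah * (exp (-U (ω + ψ)) * U'' (ω + ψ) k l)) (multivariateGaussian
      0 M⁻¹) := (iAB h k l).sub ((iB k l).const_mul ah)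
  have q1 : Integrable (fun ω : EuclideanSpace ℝ ι => exp (-U (ω + ψ)) * (U' (ω + ψ) h * U' (ω + ψ) k * U' (ω + ψ) l) - ah * (exp (-U (ω + ψ)) * (U' (ω + ψ) k * U' (ω + ψ)
      l))) (multivariateGaussian 0 M⁻¹) := iAAA.sub ((iAA k l).const_mul ah)
  have q2 : Integrable (fun ω : EuclideanSpace ℝ ι => exp (-U (ω + ψ)) * (U' (ω + ψ) h * U' (ω + ψ) k * U' (ω + ψ) l) - ah * (exp (-U (ω + ψ)) * (U' (ω + ψ) k * U' (ω + ψ)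
      l)) - ak * (exp (-U (ω + ψ)) * (U' (ω + ψ) h * U' (ω + ψ) l))) (multivariateGaussian 0 M⁻¹) := q1.sub ((iAA h l).const_mul ak)
  have q3 : Integrable (fun ω : EuclideanSpace ℝ ι => exp (-U (ω + ψ)) * (U' (ω + ψ) h * U' (ω + ψ) k * U' (ω + ψ) l) - ah * (exp (-U (ω + ψ)) * (U' (ω + ψ) k * U' (ω + ψ)
      l)) - ak * (exp (-U (ω + ψ)) * (U' (ω + ψ) h * U' (ω + ψ) l)) - al * (exp (-U (ω + ψ)) * (U' (ω + ψ) h * U' (ω + ψ) k))) (multivariateGaussian 0 M⁻¹) := q2.sub ((iAA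
      h k).const_mul al)
  have q4 : Integrable (fun ω : EuclideanSpace ℝ ι => exp (-U (ω + ψ)) * (U' (ω + ψ) h * U' (ω + ψ) k * U' (ω + ψ) l) - ah * (exp (-U (ω + ψ)) * (U' (ω + ψ) k * U' (ω + ψ)
      l)) - ak * (exp (-U (ω + ψ)) * (U' (ω + ψ) h * U' (ω + ψ) l)) - al * (exp (-U (ω + ψ)) * (U' (ω + ψ) h * U' (ω + ψ) k)) + ah * ak * (exp (-U (ω + ψ)) * U' (ω + ψ) l))
      (multivariateGaussian 0 M⁻¹) := q3.add ((iA l).const_mul _)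
  have q5 : Integrable (fun ω : EuclideanSpace ℝ ι => exp (-U (ω + ψ)) * (U' (ω + ψ) h * U' (ω + ψ) k * U' (ω + ψ) l) - ah * (exp (-U (ω + ψ)) * (U' (ω + ψ) k * U' (ω + ψ)
      l)) - ak * (exp (-U (ω + ψ)) * (U' (ω + ψ) h * U' (ω + ψ) l)) - al * (exp (-U (ω + ψ)) * (U' (ω + ψ) h * U' (ω + ψ) k)) + ah * ak * (exp (-U (ω + ψ)) * U' (ω + ψ) l)
      + ah * al * (exp (-U (ω + ψ)) * U' (ω + ψ) k)) (multivariateGaussian 0 M⁻¹) := q4.add ((iA k).const_mul _)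
  have q6 : Integrable (fun ω : EuclideanSpace ℝ ι => exp (-U (ω + ψ)) * (U' (ω + ψ) h * U' (ω + ψ) k * U' (ω + ψ) l) - ah * (exp (-U (ω + ψ)) * (U' (ω + ψ) k * U' (ω + ψ)
      l)) - ak * (exp (-U (ω + ψ)) * (U' (ω + ψ) h * U' (ω + ψ) l)) - al * (exp (-U (ω + ψ)) * (U' (ω + ψ) h * U' (ω + ψ) k)) + ah * ak * (exp (-U (ω + ψ)) * U' (ω + ψ) l)
      + ah * al * (exp (-U (ω + ψ)) * U' (ω + ψ) k) + ak * al * (exp (-U (ω + ψ)) * U' (ω + ψ) h)) (multivariateGaussian 0 M⁻¹) := q5.add ((iA h).const_mul _)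
  have q7 : Integrable (fun ω : EuclideanSpace ℝ ι => exp (-U (ω + ψ)) * (U' (ω + ψ) h * U' (ω + ψ) k * U' (ω + ψ) l) - ah * (exp (-U (ω + ψ)) * (U' (ω + ψ) k * U' (ω + ψ)
      l)) - ak * (exp (-U (ω + ψ)) * (U' (ω + ψ) h * U' (ω + ψ) l)) - al * (exp (-U (ω + ψ)) * (U' (ω + ψ) h * U' (ω + ψ) k)) + ah * ak * (exp (-U (ω + ψ)) * U' (ω + ψ) l)
      + ah * al * (exp (-U (ω + ψ)) * U' (ω + ψ) k) + ak * al * (exp (-U (ω + ψ)) * U' (ω + ψ) h) - ah * ak * al * exp (-U (ω + ψ))) (multivariateGaussian 0 M⁻¹) := q6.sub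
      (hI.const_mul _)
  have t1 : Integrable (fun ω : EuclideanSpace ℝ ι => exp (-U (ω + ψ)) * U₃ (ω + ψ) h k l - (exp (-U (ω + ψ)) * (U' (ω + ψ) k * U'' (ω + ψ) h l) - ak * (exp (-U (ω + ψ)) *
      U'' (ω + ψ) h l))) (multivariateGaussian 0 M⁻¹) := iC.sub g2
  have t2 : Integrable (fun ω : EuclideanSpace ℝ ι => exp (-U (ω + ψ)) * U₃ (ω + ψ) h k l - (exp (-U (ω + ψ)) * (U' (ω + ψ) k * U'' (ω + ψ) h l) - ak * (exp (-U (ω + ψ)) *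
      U'' (ω + ψ) h l)) - (exp (-U (ω + ψ)) * (U'' (ω + ψ) h k * U' (ω + ψ) l) - al * (exp (-U (ω + ψ)) * U'' (ω + ψ) h k))) (multivariateGaussian 0 M⁻¹) := t1.sub g3
  have t3 : Integrable (fun ω : EuclideanSpace ℝ ι => exp (-U (ω + ψ)) * U₃ (ω + ψ) h k l - (exp (-U (ω + ψ)) * (U' (ω + ψ) k * U'' (ω + ψ) h l) - ak * (exp (-U (ω + ψ)) *
      U'' (ω + ψ) h l)) - (exp (-U (ω + ψ)) * (U'' (ω + ψ) h k * U' (ω + ψ) l) - al * (exp (-U (ω + ψ)) * U'' (ω + ψ) h k)) - (exp (-U (ω + ψ)) * (U' (ω + ψ) h * U'' (ω +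
      ψ) k l) - ah * (exp (-U (ω + ψ)) * U'' (ω + ψ) k l))) (multivariateGaussian 0 M⁻¹) := t2.sub g4
  rw [integral_add t3 q7, integral_sub t2 g4, integral_sub t1 g3, integral_sub iC g2, integral_sub (iAB k h l) ((iB h l).const_mul ak),
    integral_sub (iBA h k l) ((iB h k).const_mul al), integral_sub (iAB h k l) ((iB k l).const_mul ah), integral_sub q6 (hI.const_mul _),
    integral_add q5 ((iA h).const_mul _), integral_add q4 ((iA k).const_mul _), integral_add q3 ((iA l).const_mul _), integral_sub q2 ((iAA h k).const_mul al),
    integral_sub q1 ((iAA h l).const_mul ak), integral_sub iAAA ((iAA k l).const_mul ah)]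
  simp only [integral_const_mul]

/-- **THE END — THE THIRD DERIVATIVE IS ONE TILTED EXPECTATION OF THE CENTRED INTEGRAND.** [folklore] -/
theorem hessW_deriv_apply_centred (hM : M.PosDef) (hΓop : (γop • (1 : Matrix ι ι ℝ) - M⁻¹).PosSemidef) (Y : Finset ι)
    (hUd : ∀ φ : EuclideanSpace ℝ ι, HasFDerivAt U (U' φ) φ) (hU'd : ∀ φ : EuclideanSpace ℝ ι, HasFDerivAt U' (U'' φ) φ)
    (hU''d : ∀ φ : EuclideanSpace ℝ ι, HasFDerivAt U'' (U₃ φ) φ) (hU₃c : Continuous U₃) (hκ₀ : 0 ≤ κ₀) (hκ₁ : 0 ≤ κ₁) (ha : 0 ≤ a) (hκ₂ : 0 ≤ κ₂) (hκ₃ : 0 ≤ κ₃) (hτ : 0 <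
        τ) (hδ : 0 < δ)
    (hθ0 : 0 < θ) (hθ1 : θ < 1) (hκθ : (2 * κ₀ * (1 + τ) + 4 * δ) * γop ≤ θ) (hstab : ∀ φ : EuclideanSpace ℝ ι, -(κ₀ * ∑ x ∈ Y, φ x ^ 2) ≤ U φ)
    (hU'b : ∀ φ : EuclideanSpace ℝ ι, ‖U' φ‖ ≤ κ₁ * (a + ∑ x ∈ Y, φ x ^ 2)) (hU''b : ∀ φ : EuclideanSpace ℝ ι, ‖U'' φ‖ ≤ κ₂)
    (hU₃b : ∀ φ : EuclideanSpace ℝ ι, ‖U₃ φ‖ ≤ κ₃) (ψ h k l : EuclideanSpace ℝ ι) :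
    (((∫ ω : EuclideanSpace ℝ ι, exp (-U (ω + ψ)) ∂(multivariateGaussian 0 M⁻¹))⁻¹ • (∫ ω : EuclideanSpace ℝ ι, (exp (-U (ω + ψ)) • (U₃ (ω + ψ) -
        (((ContinuousLinearMap.smulRightL ℝ (EuclideanSpace ℝ ι) (EuclideanSpace ℝ ι →L[ℝ] ℝ)) (U' (ω + ψ))).comp (U'' (ω + ψ)) + (((ContinuousLinearMap.smulRightL ℝ
        (EuclideanSpace ℝ ι) (EuclideanSpace ℝ ι →L[ℝ] ℝ))).comp (U'' (ω + ψ))).flip (U' (ω + ψ)))) + (exp (-U (ω + ψ)) • -U' (ω + ψ)).smulRight (U'' (ω + ψ) - (U' (ω +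
        ψ)).smulRight (U' (ω + ψ)))) ∂(multivariateGaussian 0 M⁻¹)) + ((-((∫ ω : EuclideanSpace ℝ ι, exp (-U (ω + ψ)) ∂(multivariateGaussian 0 M⁻¹)) ^ 2)⁻¹) • -(∫ ω :
        EuclideanSpace ℝ ι, exp (-U (ω + ψ)) • U' (ω + ψ) ∂(multivariateGaussian 0 M⁻¹))).smulRight (∫ ω : EuclideanSpace ℝ ι, exp (-U (ω + ψ)) • (U'' (ω + ψ) - (U' (ω +
        ψ)).smulRight (U' (ω + ψ))) ∂(multivariateGaussian 0 M⁻¹))) + (((ContinuousLinearMap.smulRightL ℝ (EuclideanSpace ℝ ι) (EuclideanSpace ℝ ι →L[ℝ] ℝ)) (((∫ ω :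
        EuclideanSpace ℝ ι, exp (-U (ω + ψ)) ∂(multivariateGaussian 0 M⁻¹)) ^ 2)⁻¹ • (∫ ω : EuclideanSpace ℝ ι, exp (-U (ω + ψ)) • U' (ω + ψ) ∂(multivariateGaussian 0
        M⁻¹)))).comp (∫ ω : EuclideanSpace ℝ ι, exp (-U (ω + ψ)) • (U'' (ω + ψ) - (U' (ω + ψ)).smulRight (U' (ω + ψ))) ∂(multivariateGaussian 0 M⁻¹)) +
        (((ContinuousLinearMap.smulRightL ℝ (EuclideanSpace ℝ ι) (EuclideanSpace ℝ ι →L[ℝ] ℝ))).comp (((∫ ω : EuclideanSpace ℝ ι, exp (-U (ω + ψ)) ∂(multivariateGaussian 0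
        M⁻¹)) ^ 2)⁻¹ • (∫ ω : EuclideanSpace ℝ ι, exp (-U (ω + ψ)) • (U'' (ω + ψ) - (U' (ω + ψ)).smulRight (U' (ω + ψ))) ∂(multivariateGaussian 0 M⁻¹)) + ((-2 / (∫ ω :
        EuclideanSpace ℝ ι, exp (-U (ω + ψ)) ∂(multivariateGaussian 0 M⁻¹)) ^ 3) • -(∫ ω : EuclideanSpace ℝ ι, exp (-U (ω + ψ)) • U' (ω + ψ) ∂(multivariateGaussian 0
        M⁻¹))).smulRight (∫ ω : EuclideanSpace ℝ ι, exp (-U (ω + ψ)) • U' (ω + ψ) ∂(multivariateGaussian 0 M⁻¹)))).flip (∫ ω : EuclideanSpace ℝ ι, exp (-U (ω + ψ)) • U' (ω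
        + ψ) ∂(multivariateGaussian 0 M⁻¹)))) h k l = (∫ ω : EuclideanSpace ℝ ι, exp (-U (ω + ψ)) ∂(multivariateGaussian 0 M⁻¹))⁻¹ * (∫ ω : EuclideanSpace ℝ ι, exp (-U (ω +
        ψ)) * (U₃ (ω + ψ) h k l - (U' (ω + ψ) k - ((∫ ω : EuclideanSpace ℝ ι, exp (-U (ω + ψ)) ∂(multivariateGaussian 0 M⁻¹))⁻¹ * (∫ ω : EuclideanSpace ℝ ι, exp (-U (ω +
        ψ)) * U' (ω + ψ) k ∂(multivariateGaussian 0 M⁻¹)))) * U'' (ω + ψ) h l - U'' (ω + ψ) h k * (U' (ω + ψ) l - ((∫ ω : EuclideanSpace ℝ ι, exp (-U (ω + ψ))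
        ∂(multivariateGaussian 0 M⁻¹))⁻¹ * (∫ ω : EuclideanSpace ℝ ι, exp (-U (ω + ψ)) * U' (ω + ψ) l ∂(multivariateGaussian 0 M⁻¹)))) - (U' (ω + ψ) h - ((∫ ω :
        EuclideanSpace ℝ ι, exp (-U (ω + ψ)) ∂(multivariateGaussian 0 M⁻¹))⁻¹ * (∫ ω : EuclideanSpace ℝ ι, exp (-U (ω + ψ)) * U' (ω + ψ) h ∂(multivariateGaussian 0 M⁻¹))))
        * U'' (ω + ψ) k l + (U' (ω + ψ) h - ((∫ ω : EuclideanSpace ℝ ι, exp (-U (ω + ψ)) ∂(multivariateGaussian 0 M⁻¹))⁻¹ * (∫ ω : EuclideanSpace ℝ ι, exp (-U (ω + ψ)) * U'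
        (ω + ψ) h ∂(multivariateGaussian 0 M⁻¹)))) * (U' (ω + ψ) k - ((∫ ω : EuclideanSpace ℝ ι, exp (-U (ω + ψ)) ∂(multivariateGaussian 0 M⁻¹))⁻¹ * (∫ ω : EuclideanSpace ℝ
        ι, exp (-U (ω + ψ)) * U' (ω + ψ) k ∂(multivariateGaussian 0 M⁻¹)))) * (U' (ω + ψ) l - ((∫ ω : EuclideanSpace ℝ ι, exp (-U (ω + ψ)) ∂(multivariateGaussian 0 M⁻¹))⁻¹
        * (∫ ω : EuclideanSpace ℝ ι, exp (-U (ω + ψ)) * U' (ω + ψ) l ∂(multivariateGaussian 0 M⁻¹))))) ∂(multivariateGaussian 0 M⁻¹)) := by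
  have hΓ : (M⁻¹).PosSemidef := hM.inv.posSemidef
  have hUc : Continuous U := continuous_iff_continuousAt.2 fun φ => (hUd φ).continuousAt
  have hκθ₀ : 2 * κ₀ * (1 + τ) * γop ≤ θ := mul_opBound_le_of_le (by positivity) (by linarith) hθ0.le hκθ
  have hZ : 0 < (∫ ω : EuclideanSpace ℝ ι, exp (-U (ω + ψ)) ∂(multivariateGaussian 0 M⁻¹)) := integral_exp_pos (integrable_exp_neg_block hΓ hΓop Y hUc.measurable hκ₀ hτ hθ1
      hκθ₀ hstab ψ)
  rw [hessW_deriv_apply hM hΓop Y hUd hU'd hU''d hU₃c hκ₀ hκ₁ ha hκ₂ hκ₃ hτ hδ hθ1 hκθ hstab hU'b hU''b hU₃b ψ h k l, integral_psi_split hM hΓop Y hUd hU'd hU''d hU₃c hκ₀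
      hκ₁ ha hτ hδ hθ0 hθ1 hκθ hstab hU'b hU''b hU₃b ψ h k l, integral_phi_split hM hΓop Y hUd hU'd hU''d hU₃c hκ₀ hκ₁ ha hτ hδ hθ0 hθ1 hκθ hstab hU'b hU''b hU₃b ψ h k l,
    integral_H_split hM hΓop Y hUd hU'd hU''d hU₃c hκ₀ hκ₁ ha hτ hδ hθ0 hθ1 hκθ hstab hU'b hU''b hU₃b ψ k l, integral_H_split hM hΓop Y hUd hU'd hU''d hU₃c hκ₀ hκ₁ ha hτ hδ
        hθ0 hθ1 hκθ hstab hU'b hU''b hU₃b ψ h l, integral_H_split hM hΓop Y hUd hU'd hU''d hU₃c hκ₀ hκ₁ ha hτ hδ hθ0 hθ1 hκθ hstab hU'b hU''b hU₃b ψ h k]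
  field_simp
  ring

end Main

/-! ## §3. Toy -/

/-- Toy (§2's algebra in one variable): `E[(A−a)³] = E[A³] − 3aE[A²] + 3a²E[A] − a³` at `E = id`. -/
example (A a : ℝ) : (A - a) ^ 3 = A ^ 3 - 3 * a * A ^ 2 + 3 * a ^ 2 * A - a ^ 3 := by ring

end Summit.QuantumFields.BalabanUV.T4Continuum.NE7b.SupBlockThirdCentred
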